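import Literature.NumberTheory.GaloisRepresentations.SUnitsValuation
import Literature.NumberTheory.GaloisRepresentations.IdeleSUnitsClassSequenceInflation
import HarnessLib

/-!
# The bridge `𝒪_{E,S}ˣ (as S-units of E over K) ≅ 𝒪_{E,S}ˣ (as principal S-idèles)` in `Rep ℤ Gal(E/F)` and its
# naturality in a tower (Neukirch–Schmidt–Wingberg VIII §3; Harari Lemma 15.39, §17.4 (17.1))

Topic `NumberTheory/GaloisRepresentations`; namespace `Literature.NumberTheory.GaloisRepresentations.IdeleCohomology`,
joining the two finite-layer models of the `Gal(E/F)`-module of `S`-units that the tree now has: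
* `SUnits.sUnitsRep K S F E` (`SUnitsGaloisModule.lean`): the units `x ∈ Eˣ` integral, with `x⁻¹`, over the `S`-integers
  `𝒪_{K,S}` of the ground field `K ⊆ F ⊆ E` — by `SUnits.mem_sUnits_iff_forall_valuation_eq_one` (`SUnitsValuation.lean`)
  exactly the `x` with `w(x) = 1` at every finite place `w` of `E` not above `S`;
* `sUnitsIdeleRep F E S_F` (`IdeleSUnitsClassSequence.lean`): the principal idèles inside Tate's `S_F`-idèles
  `J_{E,S_F} = ideleS F E S_F` (the kernel of `J_{E,S_F} → C_E`), for a finite set `S_F` of finite places of `F`.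
When `S_F` is the set of places of `F` above `S` (hypothesis `hSF : ∀ u, u ∈ S_F ↔ u.under (𝓞 K) ∈ S`), the principal
idèle `(x)` of `x ∈ Eˣ` lies in `J_{E,S_F}` iff `x` is an `S`-unit (Harari Lemma 15.39, proof: "`𝒪_{F,S}^*` identifies with
a subgroup of `J_{F,S}` via `i : a ↦ (a, …, a, 1, 1, …)`" and "`J_{F,S} ∩ (F^*·U_{F,S}) = i(𝒪_{F,S}^*)`"), so `x ↦ (x)` is
an isomorphism `SUnits.sUnitsRep K S F E ≅ sUnitsIdeleRep F E S_F` of `Gal(E/F)`-modules (by the kernel universal property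
`isIso_sUnitsIdeleLift`), natural in towers `F ⊆ E ⊆ E'` with respect to the inclusion `𝒪_{E,S}ˣ ⊆ 𝒪_{E',S}ˣ` on one side
and the base change of principal `S`-idèles (`sUnitsIdeleInflHom`) on the other.  Definitions with bodies (three morphisms,
one isomorphism) and theorems; NO named fact, no `sorry`, no instance, no notation; number fields in `Type`.

## What is formalised (`K F E : Type` number fields, `K ⊆ F ⊆ E`; `S : Set (HeightOneSpectrum (𝓞 K))`,
## `S_F : Finset (HeightOneSpectrum (𝓞 F))`, `hSF : ∀ u, u ∈ S_F ↔ u.under (𝓞 K) ∈ S`)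

* §1 `valued_principal_snd` (`|(x)_w|_w = |x|_w`), `principal_mem_ideleS_iff_mem_sUnits` (`(x) ∈ J_{E,S_F} ↔ x ∈ 𝒪_{E,S}ˣ`).
* §2 `sUnitsToIdeleS S S_F hSF : SUnits.sUnitsRep K S F E ⟶ ideleSRep F E S_F` (`x ↦ (x)`), injective / mono, dying in `C_E`
  (`sUnitsToIdeleS_comp_ideleSToClass`), with range the principal `S_F`-idèles (`exists_sUnitsToIdeleS_eq_iff`).
* §3 `sUnitsBridge S S_F hSF : SUnits.sUnitsRep K S F E ⟶ sUnitsIdeleRep F E S_F`, `sUnitsBridge_comp_ι`, `isIso_sUnitsBridge`,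
  `sUnitsBridgeIso`.
* §4 towers `F ⊆ E ⊆ E'`: `sUnitsRepInflHom (K := K) (F := F) (E := E) (E' := E') S : Res_{res}(𝒪_{E,S}ˣ) ⟶ 𝒪_{E',S}ˣ` (the inclusion as a pair
  morphism over `res = AlgEquiv.restrictNormalHom E`), `sUnitsRepInflHom_comp_sUnitsToIdeleS` (naturality against
  `ideleSInflHom`), `sUnitsRepInflHom_comp_sUnitsBridge` (naturality of the bridge against `sUnitsIdeleInflHom`),
  `sUnitsRepInf (K := K) (F := F) (E := E) (E' := E') S n` and `sUnitsRepInf_comp_map_sUnitsBridge` (the square on `Hⁿ`).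

## References
* J. Neukirch, A. Schmidt, K. Wingberg, *Cohomology of Number Fields*, 2nd ed. (2008), VIII §3 (`E_{K,S} = 𝒪_{K,S}^×`,
  (8.3.9)–(8.3.11)). [NeukirchSchmidtWingberg2008]
* D. Harari, *Galois Cohomology and Class Field Theory*, Universitext, Springer (2020), Lemma 15.39 (proof), §17.4 (17.1).
  [Harari2020]
* J. W. S. Cassels, A. Fröhlich (eds.), *Algebraic Number Theory* (1967), Ch. II §17–§19 (idèles, conorm), Ch. VII §8.
  [CasselsFrohlichANT1967]
-/

noncomputable section

open NumberField IsDedekindDomain CategoryTheory CategoryTheory.Limits groupCohomology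
open Literature.NumberTheory.Automorphic

namespace Literature.NumberTheory.GaloisRepresentations

namespace IdeleCohomology

open Literature.Algebra.Homology

variable {K F E : Type} [Field K] [NumberField K] [Field F] [NumberField F] [Field E] [NumberField E]
  [Algebra K F] [Algebra K E] [Algebra F E] [IsScalarTower K F E]
variable (S : Set (HeightOneSpectrum (𝓞 K))) (S_F : Finset (HeightOneSpectrum (𝓞 F)))

/-! ## §1. A principal idèle is an `S_F`-idèle iff the element is an `S`-unit -/

omit [NumberField F] [Algebra K F] [Algebra K E] [Algebra F E] [IsScalarTower K F E] [NumberField K] in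
/-- **`|(x)_w|_w = |x|_w`**: the `w`-component of the principal idèle of `x ∈ Eˣ` has valuation `w(x)` (tree
`principalIdele_snd`, `valued_algebraMap_adicCompletion`). [cite: CasselsFrohlichANT1967, Ch. II §17 (principal idèles)] -/
theorem valued_principal_snd (x : Eˣ) (w : HeightOneSpectrum (𝓞 E)) :
    Valued.v (((IdeleHerbrand.principal E x : ideleGroup E) : AdeleRing (𝓞 E) E).2 w) = w.valuation E (x : E) := by
  change Valued.v ((principalIdele E x : AdeleRing (𝓞 E) E).2 w) = _
  rw [principalIdele_snd, valued_algebraMap_adicCompletion]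

omit [NumberField F] in
/-- **`(x) ∈ J_{E,S_F} ↔ x ∈ 𝒪_{E,S}ˣ`** when `S_F` is the set of places of `F` above `S`: both say `w(x) = 1` at every finite
place `w` of `E` not above `S` ((A1b) `SUnits.mem_sUnits_iff_forall_valuation_eq_one`; `(w ∩ F) ∩ K = w ∩ K`).
[cite: Harari2020, Lemma 15.39 (proof: `J_{F,S} ∩ (F^*·U_{F,S}) = i(𝒪_{F,S}^*)`)][cite: NeukirchSchmidtWingberg2008, VIII §3] -/
theorem principal_mem_ideleS_iff_mem_sUnits (hSF : ∀ u : HeightOneSpectrum (𝓞 F), u ∈ S_F ↔ u.under (𝓞 K) ∈ S) (x : Eˣ) :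
    IdeleHerbrand.principal E x ∈ ideleS F E S_F ↔ x ∈ SUnits.sUnits K S E := by
  rw [mem_ideleS_iff, SUnits.mem_sUnits_iff_forall_valuation_eq_one]
  refine forall_congr' fun w => ?_
  rw [valued_principal_snd, hSF, HeightOneSpectrum.under_under K F E w]

/-! ## §2. `x ↦ (x)`: `𝒪_{E,S}ˣ → J_{E,S_F}` as a morphism of `Gal(E/F)`-modules -/

/-- `𝒪_{E,S}ˣ →* J_{E,S_F}`, `x ↦ (x)` (multiplicative). [cite: Harari2020, Lemma 15.39 (the map `i`)] -/
def sUnitsToIdeleSHom (hSF : ∀ u : HeightOneSpectrum (𝓞 F), u ∈ S_F ↔ u.under (𝓞 K) ∈ S) :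
    SUnits.sUnits K S E →* ideleS F E S_F :=
  ((IdeleHerbrand.principal E).comp (SUnits.sUnits K S E).subtype).codRestrict (ideleS F E S_F)
    fun x => (principal_mem_ideleS_iff_mem_sUnits S S_F hSF (x : Eˣ)).2 x.2

omit [NumberField F] in
/-- Unfolding on underlying idèles. [cite: Harari2020, Lemma 15.39] -/
theorem coe_sUnitsToIdeleSHom (hSF : ∀ u : HeightOneSpectrum (𝓞 F), u ∈ S_F ↔ u.under (𝓞 K) ∈ S)
    (x : SUnits.sUnits K S E) :
    ((sUnitsToIdeleSHom S S_F hSF x : ideleS F E S_F) : ideleGroup E) = IdeleHerbrand.principal E (x : Eˣ) := rfl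

/-- **`𝒪_{E,S}ˣ → J_{E,S_F}`, `x ↦ (x)`, as a morphism `SUnits.sUnitsRep K S F E ⟶ ideleSRep F E S_F` of `Rep ℤ Gal(E/F)`**
(equivariance `(σ x) = σ • (x)`, tree `IdeleHerbrand.principal_smul`). [cite: Harari2020, Lemma 15.39 (the map `i`)]
[cite: NeukirchSchmidtWingberg2008, VIII §3 (8.3.9)] -/
def sUnitsToIdeleS (hSF : ∀ u : HeightOneSpectrum (𝓞 F), u ∈ S_F ↔ u.under (𝓞 K) ∈ S) :
    SUnits.sUnitsRep K S F E ⟶ ideleSRep F E S_F :=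
  Rep.ofHom (LinearMap.intertwiningMap_of_isIntertwiningMap (SUnits.sUnitsRep K S F E).ρ (ideleSRep F E S_F).ρ
    (MonoidHom.toAdditive (sUnitsToIdeleSHom S S_F hSF)).toIntLinearMap fun σ x => by
      apply (Additive.toMul (α := ideleS F E S_F)).injective
      refine Subtype.ext ?_
      change IdeleHerbrand.principal E (((Additive.toMul ((SUnits.sUnitsRep K S F E).ρ σ x)) : SUnits.sUnits K S E) : Eˣ) =
        σ • IdeleHerbrand.principal E ((Additive.toMul x : SUnits.sUnits K S E) : Eˣ)
      rw [SUnits.coe_toMul_sUnitsRep_ρ, IdeleHerbrand.principal_smul])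

/-- Unfolding `sUnitsToIdeleS` on underlying idèles: it is the principal idèle. [cite: Harari2020, Lemma 15.39] -/
theorem coe_toMul_sUnitsToIdeleS_hom_apply (hSF : ∀ u : HeightOneSpectrum (𝓞 F), u ∈ S_F ↔ u.under (𝓞 K) ∈ S)
    (x : (SUnits.sUnitsRep K S F E).V) :
    ((Additive.toMul ((sUnitsToIdeleS S S_F hSF).hom x) : ideleS F E S_F) : ideleGroup E) =
      IdeleHerbrand.principal E ((Additive.toMul x : SUnits.sUnits K S E) : Eˣ) := rfl

/-- `x ↦ (x)` is injective. [cite: Harari2020, Lemma 15.39] -/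
theorem sUnitsToIdeleS_injective (hSF : ∀ u : HeightOneSpectrum (𝓞 F), u ∈ S_F ↔ u.under (𝓞 K) ∈ S) :
    Function.Injective (sUnitsToIdeleS (E := E) S S_F hSF).hom := fun a b h => by
  apply (Additive.toMul (α := SUnits.sUnits K S E)).injective
  refine Subtype.ext (IdeleHerbrand.principal_injective ?_)
  rw [← coe_toMul_sUnitsToIdeleS_hom_apply S S_F hSF a, ← coe_toMul_sUnitsToIdeleS_hom_apply S S_F hSF b, h]

/-- `x ↦ (x)` is a monomorphism. [cite: Harari2020, Lemma 15.39] -/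
theorem mono_sUnitsToIdeleS (hSF : ∀ u : HeightOneSpectrum (𝓞 F), u ∈ S_F ↔ u.under (𝓞 K) ∈ S) :
    Mono (sUnitsToIdeleS (E := E) S S_F hSF) :=
  (Rep.mono_iff_injective _).2 (sUnitsToIdeleS_injective S S_F hSF)

/-- `𝒪_{E,S}ˣ → J_{E,S_F} → C_E` is zero (principal idèles have trivial class). [cite: Harari2020, Lemma 15.39] -/
theorem sUnitsToIdeleS_comp_ideleSToClass (hSF : ∀ u : HeightOneSpectrum (𝓞 F), u ∈ S_F ↔ u.under (𝓞 K) ∈ S) :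
    sUnitsToIdeleS (E := E) S S_F hSF ≫ ideleSToClass S_F = 0 :=
  Rep.hom_ext (Representation.IntertwiningMap.ext (LinearMap.ext fun x =>
    (ideleSToClass_hom_apply_eq_zero_iff S_F _).2 ⟨((Additive.toMul x : SUnits.sUnits K S E) : Eˣ), rfl⟩))

/-- **The range of `x ↦ (x)` is the set of principal `S_F`-idèles** (an `S_F`-idèle `(k)`, `k ∈ Eˣ`, has `k ∈ 𝒪_{E,S}ˣ` by §1)
— the hypothesis `hO` of the layer chase for `O = SUnits.sUnitsRep K S F E`.
[cite: Harari2020, Lemma 15.39 (proof: `J_{F,S} ∩ (F^*·U_{F,S}) = i(𝒪_{F,S}^*)`)] -/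
theorem exists_sUnitsToIdeleS_eq_iff (hSF : ∀ u : HeightOneSpectrum (𝓞 F), u ∈ S_F ↔ u.under (𝓞 K) ∈ S)
    (x : (ideleSRep F E S_F).V) :
    (∃ o, (sUnitsToIdeleS S S_F hSF).hom o = x) ↔
      ((Additive.toMul x : ideleS F E S_F) : ideleGroup E) ∈ principalIdeles E := by
  constructor
  · rintro ⟨o, rfl⟩
    exact ⟨((Additive.toMul o : SUnits.sUnits K S E) : Eˣ), rfl⟩
  · rintro ⟨k, hk⟩
    have hkS : IdeleHerbrand.principal E k ∈ ideleS F E S_F := by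
      rw [show IdeleHerbrand.principal E k = ((Additive.toMul x : ideleS F E S_F) : ideleGroup E) from hk]
      exact (Additive.toMul x).2
    refine ⟨Additive.ofMul ⟨k, (principal_mem_ideleS_iff_mem_sUnits S S_F hSF k).1 hkS⟩, ?_⟩
    apply (Additive.toMul (α := ideleS F E S_F)).injective
    exact Subtype.ext hk

/-! ## §3. The bridge `SUnits.sUnitsRep K S F E ≅ sUnitsIdeleRep F E S_F` -/

/-- **The bridge `𝒪_{E,S}ˣ → (principal S_F-idèles)`**: the lift of `x ↦ (x)` through the kernel `sUnitsIdeleRep F E S_F ↪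
J_{E,S_F}` of `J_{E,S_F} → C_E`. [cite: Harari2020, Lemma 15.39][cite: NeukirchSchmidtWingberg2008, VIII §3 (8.3.9)] -/
def sUnitsBridge (hSF : ∀ u : HeightOneSpectrum (𝓞 F), u ∈ S_F ↔ u.under (𝓞 K) ∈ S) :
    SUnits.sUnitsRep K S F E ⟶ sUnitsIdeleRep F E S_F :=
  sUnitsIdeleLift (sUnitsToIdeleS S S_F hSF) (sUnitsToIdeleS_comp_ideleSToClass S S_F hSF)

/-- The bridge followed by the inclusion into `J_{E,S_F}` is `x ↦ (x)`. [cite: Harari2020, Lemma 15.39] -/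
theorem sUnitsBridge_comp_ι (hSF : ∀ u : HeightOneSpectrum (𝓞 F), u ∈ S_F ↔ u.under (𝓞 K) ∈ S) :
    sUnitsBridge (E := E) S S_F hSF ≫ sUnitsIdeleι S_F = sUnitsToIdeleS S S_F hSF :=
  sUnitsIdeleLift_comp_ι _ _

/-- **The bridge is an isomorphism.** [cite: Harari2020, Lemma 15.39 (proof: `J_{F,S} ∩ (F^*·U_{F,S}) = i(𝒪_{F,S}^*)`)]
[cite: NeukirchSchmidtWingberg2008, VIII §3 (`E_{K,S} = 𝒪_{K,S}^×`)] -/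
theorem isIso_sUnitsBridge (hSF : ∀ u : HeightOneSpectrum (𝓞 F), u ∈ S_F ↔ u.under (𝓞 K) ∈ S) :
    IsIso (sUnitsBridge (E := E) S S_F hSF) := by
  haveI := mono_sUnitsToIdeleS (E := E) S S_F hSF
  exact isIso_sUnitsIdeleLift _ _ fun x hx =>
    (exists_sUnitsToIdeleS_eq_iff S S_F hSF x).2 ((ideleSToClass_hom_apply_eq_zero_iff S_F x).1 hx)

/-- **`SUnits.sUnitsRep K S F E ≅ sUnitsIdeleRep F E S_F`**: the two finite-layer models of the `Gal(E/F)`-module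
`𝒪_{E,S}ˣ` agree. [cite: Harari2020, Lemma 15.39][cite: NeukirchSchmidtWingberg2008, VIII §3] -/
def sUnitsBridgeIso (hSF : ∀ u : HeightOneSpectrum (𝓞 F), u ∈ S_F ↔ u.under (𝓞 K) ∈ S) :
    SUnits.sUnitsRep K S F E ≅ sUnitsIdeleRep F E S_F :=
  haveI := isIso_sUnitsBridge (E := E) S S_F hSF
  asIso (sUnitsBridge S S_F hSF)

/-- The isomorphism's forward map is the bridge. [cite: Harari2020, Lemma 15.39] -/
theorem sUnitsBridgeIso_hom (hSF : ∀ u : HeightOneSpectrum (𝓞 F), u ∈ S_F ↔ u.under (𝓞 K) ∈ S) :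
    (sUnitsBridgeIso (E := E) S S_F hSF).hom = sUnitsBridge S S_F hSF := rfl

/-! ## §4. Towers `F ⊆ E ⊆ E'`: the inclusion `𝒪_{E,S}ˣ ⊆ 𝒪_{E',S}ˣ` and naturality of the bridge -/

section Tower

variable {E' : Type} [Field E'] [NumberField E'] [Algebra E E'] [Algebra F E'] [Algebra K E']
  [IsScalarTower F E E'] [IsScalarTower K E E'] [IsScalarTower K F E']

omit [NumberField E] [NumberField E'] in
/-- `𝒪_{E,S}ˣ →* 𝒪_{E',S}ˣ`, the inclusion (multiplicative; (A1) `SUnits.map_mem_sUnits` for `E →ₐ[K] E'`).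
[cite: NeukirchSchmidtWingberg2008, VIII §3 (`E_S = lim→ E_{K,S}`)] -/
def sUnitsInclHom : SUnits.sUnits K S E →* SUnits.sUnits K S E' :=
  ((Units.map (algebraMap E E').toMonoidHom).comp (SUnits.sUnits K S E).subtype).codRestrict (SUnits.sUnits K S E')
    fun x => by
      have h := SUnits.map_mem_sUnits (S := S) (IsScalarTower.toAlgHom K E E') x.2
      have e : Units.map ((IsScalarTower.toAlgHom K E E' : E →ₐ[K] E') : E →* E') (x : Eˣ) =
          Units.map (algebraMap E E').toMonoidHom (x : Eˣ) := Units.ext rfl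
      rwa [e] at h

omit [NumberField E] [NumberField E'] in
/-- Unfolding on values. [cite: NeukirchSchmidtWingberg2008, VIII §3] -/
theorem coe_sUnitsInclHom (x : SUnits.sUnits K S E) :
    (((sUnitsInclHom (E' := E') S x : SUnits.sUnits K S E') : E'ˣ) : E') = algebraMap E E' ((x : Eˣ) : E) := rfl

variable [Normal F E]

omit [NumberField F] [NumberField E] [NumberField E'] in
/-- **`𝒪_{E,S}ˣ ⊆ 𝒪_{E',S}ˣ` as a morphism `Res_{res}(𝒪_{E,S}ˣ) ⟶ 𝒪_{E',S}ˣ` of `Gal(E'/F)`-modules** (`τ(x) = (τ|_E)(x)` for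
`x ∈ E`, Mathlib `AlgEquiv.restrictNormal_commutes`) — the transition map of NSW's / Harari's direct system `E_S = lim→ 𝒪_{E,S}ˣ`
at the finite layers, in the (A1) model. [cite: NeukirchSchmidtWingberg2008, VIII §3 (`E_S = lim→ E_{K,S}`)][cite: Harari2020, §17.4 (17.1)] -/
def sUnitsRepInflHom :
    Rep.res (AlgEquiv.restrictNormalHom E) (SUnits.sUnitsRep K S F E) ⟶ SUnits.sUnitsRep K S F E' :=
  Rep.ofHom (LinearMap.intertwiningMap_of_isIntertwiningMap
    (Rep.res (AlgEquiv.restrictNormalHom E) (SUnits.sUnitsRep K S F E)).ρ (SUnits.sUnitsRep K S F E').ρ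
    (MonoidHom.toAdditive (sUnitsInclHom (E' := E') S)).toIntLinearMap fun τ x => by
      apply (Additive.toMul (α := SUnits.sUnits K S E')).injective
      refine Subtype.ext (Units.ext ?_)
      change algebraMap E E'
          (((AlgEquiv.restrictNormalHom E τ) • ((Additive.toMul x : SUnits.sUnits K S E) : Eˣ) : Eˣ) : E) =
        ((τ • ((sUnitsInclHom (E' := E') S (Additive.toMul x) : SUnits.sUnits K S E') : E'ˣ) : E'ˣ) : E')
      rw [AlgEquiv.smul_units_def, AlgEquiv.smul_units_def, Units.coe_map, Units.coe_map, MonoidHom.coe_coe,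
        MonoidHom.coe_coe, coe_sUnitsInclHom]
      exact AlgEquiv.restrictNormal_commutes τ E _)

omit [NumberField F] [NumberField E] [NumberField E'] in
/-- Unfolding `sUnitsRepInflHom` on values: it is the inclusion `E ⊆ E'`. [cite: NeukirchSchmidtWingberg2008, VIII §3] -/
theorem coe_toMul_sUnitsRepInflHom_hom_apply (x : (Rep.res (AlgEquiv.restrictNormalHom E) (SUnits.sUnitsRep K S F E)).V) :
    (((Additive.toMul ((sUnitsRepInflHom (K := K) (F := F) (E := E) (E' := E') S).hom x) : SUnits.sUnits K S E') : E'ˣ) : E') =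
      algebraMap E E' (((Additive.toMul x : SUnits.sUnits K S E) : Eˣ) : E) := rfl

/-- **Naturality of `x ↦ (x)`**: `(𝒪_{E,S}ˣ ⊆ 𝒪_{E',S}ˣ) ≫ (x ↦ (x))_{E'} = Res(x ↦ (x))_E ≫ (J_{E,S_F} → J_{E',S_F})` — the principal
idèle of `x ∈ E ⊆ E'` is the base change of the principal idèle of `x` (tree `AdeleRing.baseChange_algebraMap`).
[cite: CasselsFrohlichANT1967, Ch. VII §11.1][cite: NeukirchSchmidtWingberg2008, VIII §3 (8.3.9)] -/
theorem sUnitsRepInflHom_comp_sUnitsToIdeleS (hSF : ∀ u : HeightOneSpectrum (𝓞 F), u ∈ S_F ↔ u.under (𝓞 K) ∈ S) :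
    sUnitsRepInflHom (K := K) (F := F) (E := E) (E' := E') S ≫ sUnitsToIdeleS (E := E') S S_F hSF =
      (Rep.resFunctor (AlgEquiv.restrictNormalHom E)).map (sUnitsToIdeleS S S_F hSF) ≫ ideleSInflHom F E E' S_F := by
  refine Rep.hom_ext (Representation.IntertwiningMap.ext (LinearMap.ext fun x => ?_))
  apply (Additive.toMul (α := ideleS F E' S_F)).injective
  refine Subtype.ext (Units.ext ?_)
  change ((IdeleHerbrand.principal E' (((sUnitsInclHom (E' := E') S (Additive.toMul x)) : E'ˣ)) : ideleGroup E') :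
      AdeleRing (𝓞 E') E') =
    ((AdeleRing.ideleBaseChange E E'
      (IdeleHerbrand.principal E ((Additive.toMul x : SUnits.sUnits K S E) : Eˣ)) : ideleGroup E') : AdeleRing (𝓞 E') E')
  rw [AdeleRing.coe_ideleBaseChange]
  change algebraMap E' (AdeleRing (𝓞 E') E') (algebraMap E E' (((Additive.toMul x : SUnits.sUnits K S E) : Eˣ) : E)) =
    Literature.NumberTheory.Automorphic.AdeleRing.baseChange E E'
      (algebraMap E (AdeleRing (𝓞 E) E) (((Additive.toMul x : SUnits.sUnits K S E) : Eˣ) : E))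
  rw [AdeleRing.baseChange_algebraMap]

/-- **Naturality of the bridge**: `(𝒪_{E,S}ˣ ⊆ 𝒪_{E',S}ˣ) ≫ bridge_{E'} = Res(bridge_E) ≫ sUnitsIdeleInflHom F E E' S_F` (both
followed by the monomorphism `sUnitsIdeleι S_F` give the previous square). [cite: CasselsFrohlichANT1967, Ch. VII §11.1]
[cite: NeukirchSchmidtWingberg2008, VIII §3 (8.3.9)] -/
theorem sUnitsRepInflHom_comp_sUnitsBridge (hSF : ∀ u : HeightOneSpectrum (𝓞 F), u ∈ S_F ↔ u.under (𝓞 K) ∈ S) :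
    sUnitsRepInflHom (K := K) (F := F) (E := E) (E' := E') S ≫ sUnitsBridge (E := E') S S_F hSF =
      (Rep.resFunctor (AlgEquiv.restrictNormalHom E)).map (sUnitsBridge S S_F hSF) ≫ sUnitsIdeleInflHom F E E' S_F := by
  haveI := mono_sUnitsIdeleι (F := F) (E := E') S_F
  rw [← cancel_mono (sUnitsIdeleι (F := F) (E := E') S_F), Category.assoc, sUnitsBridge_comp_ι,
    sUnitsRepInflHom_comp_sUnitsToIdeleS, Category.assoc, sUnitsIdeleInflHom_comp_ι, ← Category.assoc,
    ← Functor.map_comp, sUnitsBridge_comp_ι]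

omit [NumberField F] [NumberField E] [NumberField E'] in
/-- **`Inf : Hⁿ(Gal(E/F), 𝒪_{E,S}ˣ) → Hⁿ(Gal(E'/F), 𝒪_{E',S}ˣ)`** in the (A1) model (Mathlib `groupCohomology.map res _ n`).
[cite: NeukirchSchmidtWingberg2008, VIII §3 (8.3.11)][cite: Harari2020, §17.4 (17.1)] -/
def sUnitsRepInf (n : ℕ) :
    groupCohomology (SUnits.sUnitsRep K S F E) n ⟶ groupCohomology (SUnits.sUnitsRep K S F E') n :=
  groupCohomology.map (AlgEquiv.restrictNormalHom E) (sUnitsRepInflHom (K := K) (F := F) (E := E) (E' := E') S) n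

/-- **The square on `Hⁿ`**: `Inf_{(A1)} ≫ Hⁿ(bridge_{E'}) = Hⁿ(bridge_E) ≫ Inf_{idelic}` — the two models of the direct system
`Hⁿ(Gal(·/F), 𝒪ˣ_{·,S})` are isomorphic as direct systems. [cite: NeukirchSchmidtWingberg2008, VIII §3 (8.3.11)] -/
theorem sUnitsRepInf_comp_map_sUnitsBridge (hSF : ∀ u : HeightOneSpectrum (𝓞 F), u ∈ S_F ↔ u.under (𝓞 K) ∈ S) (n : ℕ) :
    sUnitsRepInf (K := K) (F := F) (E := E) (E' := E') S n ≫ groupCohomology.map (MonoidHom.id _) (sUnitsBridge (E := E') S S_F hSF) n =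
      groupCohomology.map (MonoidHom.id _) (sUnitsBridge S S_F hSF) n ≫ sUnitsIdeleInf F E E' S_F n := by
  rw [sUnitsRepInf, sUnitsIdeleInf, ← groupCohomology.map_comp, ← groupCohomology.map_comp]
  exact map_congr' (by rw [MonoidHom.id_comp, MonoidHom.comp_id]) _ _
    (fun x => congrArg (fun φ => φ.hom x) (sUnitsRepInflHom_comp_sUnitsBridge (E := E) (E' := E') S S_F hSF)) n

end Tower

end IdeleCohomology

end Literature.NumberTheory.GaloisRepresentations

end
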